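import Summits.QuantumFields.BalabanUV.Beta.EriceFlowEnclosureBorelRays

/-!
# Beta / EriceFlowEnclosureBorelShiftedRays — RAY DEFORMATION WITH A START CONNECTOR: inside a convex open set two ray integrals
# `∫_{s>a} h(q_j + s·u_j)·u_j ds` of a holomorphic `h` with DIFFERENT starting points differ by the segment integral between the
# starts, `∫₀¹ h(p₁ + σ(p₂ − p₁))·(p₂ − p₁) dσ`, as soon as the far connector has `sup‖h‖ × length → 0` (34a's common-start lemma
# plus FTC along the start segment) — the contour move behind the converse of Nevanlinna's theorem on the WHOLE Borel disc
# (bflow-p3 gen 39 ∕ 40, MODULE 37a over 34a; Mathlib + tree only)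

HONEST FRAMING (page 1 of everything the β sub-cell writes): discharging `BetaPertH` makes Bałaban's UV stability UNCONDITIONAL — a
real constructive-QFT result; it is NOT the continuum limit and NOT the Clay problem.  HONEST DEPENDENCY (cell reorg 2026-08-19,
verbatim): «continuum YM on T⁴ ⇐ BetaPertH ∧ nine spine estimates (0/9 proved); BetaPertH ⇐ (D1) ∧ (D4) ∧ CAP+tail; G-an2-4 gates
asym, D1 and NE2/3/4.»  THIS MODULE DISCHARGES NOTHING: [folklore] one-variable complex analysis over Mathlib.

SOURCE (shapes only).  [LodayRichaud2016] Thm 5.3.9 (i)⇒(ii), proof pp. 157–158 («from Cauchy's theorem we can integrate as well on a path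
γ_b homotopic to [0, +∞[ in Σ_B … a straight line from 0 to b^k and … a horizontal line from b^k to +∞»).

WHAT THIS FILE PROVES (0 sorry, 0 def).  `integral_segment_eq_sub` (FTC along a segment against a primitive), HEADLINE
**`integral_ray_sub_integral_ray_eq_segment`**, and its horizontal form **`integral_Ioi_sub_integral_Ioi_shift`**
(`∫_{s>0} h(s) − ∫_{s>0} h(b+s) = ∫₀¹ h(σb)·b dσ` when `‖h(R + σb)‖ ≤ C₀e^{−λR}` — the path `γ_b` of 37c).
NOT CLAIMED: anything about Erice's β; `BetaPertH`, continuum, Clay.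
-/

namespace Summit.QuantumFields.BalabanUV.Beta.EriceFlowEnclosureBorelShiftedRays

open Set Filter Topology MeasureTheory Metric Complex
open scoped Real
open Summit.QuantumFields.BalabanUV.Beta.EriceFlowEnclosureBorelRays (integral_ray_eq_sub)

noncomputable section

/-- FTC along the segment `σ ↦ p₁ + σ·(p₂ − p₁)`, `σ ∈ [0,1]`, inside a set carrying a primitive `Φ` of `h`:
`∫₀¹ h(p₁ + σ(p₂ − p₁))·(p₂ − p₁) dσ = Φ p₂ − Φ p₁`. [folklore] -/
theorem integral_segment_eq_sub {U : Set ℂ} {h Φ : ℂ → ℂ} (hΦ : ∀ w ∈ U, HasDerivAt Φ (h w) w)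
    (hh : ContinuousOn h U) {p₁ p₂ : ℂ} (hseg : ∀ σ : ℝ, σ ∈ Icc (0 : ℝ) 1 → p₁ + σ * (p₂ - p₁) ∈ U) :
    ∫ σ in (0 : ℝ)..1, h (p₁ + σ * (p₂ - p₁)) * (p₂ - p₁) = Φ p₂ - Φ p₁ := by
  have hderiv : ∀ σ ∈ uIcc (0 : ℝ) 1,
      HasDerivAt (fun σ : ℝ => Φ (p₁ + (σ : ℂ) * (p₂ - p₁))) (h (p₁ + σ * (p₂ - p₁)) * (p₂ - p₁)) σ := by
    intro σ hσ
    rw [uIcc_of_le zero_le_one] at hσ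
    have hC : HasDerivAt (fun w : ℂ => Φ (p₁ + w * (p₂ - p₁))) (h (p₁ + (σ : ℂ) * (p₂ - p₁)) * (p₂ - p₁)) (σ : ℂ) := by
      have h1 : HasDerivAt (fun w : ℂ => p₁ + w * (p₂ - p₁)) (p₂ - p₁) (σ : ℂ) := by
        simpa using ((hasDerivAt_id (σ : ℂ)).mul_const (p₂ - p₁)).const_add p₁
      exact (hΦ _ (hseg σ hσ)).comp (σ : ℂ) h1
    exact hC.comp_ofReal
  have hcont : ContinuousOn (fun σ : ℝ => h (p₁ + σ * (p₂ - p₁)) * (p₂ - p₁)) (uIcc (0 : ℝ) 1) := by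
    rw [uIcc_of_le zero_le_one]
    refine ContinuousOn.mul ?_ continuousOn_const
    exact hh.comp (by fun_prop) fun σ hσ => hseg σ hσ
  have h := intervalIntegral.integral_eq_sub_of_hasDerivAt hderiv hcont.intervalIntegrable
  simpa using h

/-- **Ray deformation with a start connector.**  `h` holomorphic on a convex open `U`; two affine rays `s ↦ q_j + s·u_j` (`s ≥ a`)
in `U` with starting points `p_j = q_j + a·u_j`; both ray integrals absolutely convergent; the far connector between `q_j + R·u_j`
has `sup‖h‖ × length → 0`.  Then
`∫_{s>a} h(q₁ + s u₁)·u₁ ds − ∫_{s>a} h(q₂ + s u₂)·u₂ ds = ∫₀¹ h(p₁ + σ(p₂ − p₁))·(p₂ − p₁) dσ`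
(the segment `[p₁, p₂]` lies in `U` by convexity; primitive on `U`, FTC along rays and segment, mean value on the far connector).
[folklore] -/
theorem integral_ray_sub_integral_ray_eq_segment {U : Set ℂ} (hUo : IsOpen U) (hUc : Convex ℝ U) {h : ℂ → ℂ}
    (hh : DifferentiableOn ℂ h U) {q₁ q₂ u₁ u₂ : ℂ} {a : ℝ}
    (hray₁ : ∀ s : ℝ, a ≤ s → q₁ + s * u₁ ∈ U) (hray₂ : ∀ s : ℝ, a ≤ s → q₂ + s * u₂ ∈ U)
    (hint₁ : IntegrableOn (fun s : ℝ => h (q₁ + s * u₁) * u₁) (Ioi a))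
    (hint₂ : IntegrableOn (fun s : ℝ => h (q₂ + s * u₂) * u₂) (Ioi a))
    {M : ℝ → ℝ} (hM : Tendsto M atTop (𝓝 0))
    (hfar : ∀ᶠ R : ℝ in atTop, ∃ B : ℝ, (∀ w ∈ segment ℝ (q₁ + R * u₁) (q₂ + R * u₂), ‖h w‖ ≤ B) ∧
      B * ‖(q₂ + R * u₂) - (q₁ + R * u₁)‖ ≤ M R) :
    (∫ s in Ioi a, h (q₁ + s * u₁) * u₁) - (∫ s in Ioi a, h (q₂ + s * u₂) * u₂) =
      ∫ σ in (0 : ℝ)..1, h ((q₁ + a * u₁) + σ * ((q₂ + a * u₂) - (q₁ + a * u₁))) * ((q₂ + a * u₂) - (q₁ + a * u₁)) := by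
  obtain ⟨Φ, hΦ⟩ := hUc.exists_forall_hasDerivWithinAt hh
  have hΦ' : ∀ w ∈ U, HasDerivAt Φ (h w) w := fun w hw => (hΦ w hw).hasDerivAt (hUo.mem_nhds hw)
  have hhc : ContinuousOn h U := hh.continuousOn
  set p₁ : ℂ := q₁ + a * u₁ with hp₁
  set p₂ : ℂ := q₂ + a * u₂ with hp₂
  -- the segment between the starts lies in `U`
  have hseg : ∀ σ : ℝ, σ ∈ Icc (0 : ℝ) 1 → p₁ + σ * (p₂ - p₁) ∈ U := by
    intro σ hσ
    have hmem : p₁ + (σ : ℂ) * (p₂ - p₁) ∈ segment ℝ p₁ p₂ := by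
      rw [segment_eq_image]
      refine ⟨σ, hσ, ?_⟩
      simp only [Complex.real_smul]
      push_cast
      ring
    exact hUc.segment_subset (hray₁ a le_rfl) (hray₂ a le_rfl) hmem
  have hsegval := integral_segment_eq_sub hΦ' hhc hseg
  -- the ray integrals as limits
  have hlim : ∀ q u : ℂ, (∀ s : ℝ, a ≤ s → q + s * u ∈ U) → IntegrableOn (fun s : ℝ => h (q + s * u) * u) (Ioi a) →
      Tendsto (fun R : ℝ => Φ (q + R * u) - Φ (q + a * u)) atTop (𝓝 (∫ s in Ioi a, h (q + s * u) * u)) := by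
    intro q u hray hint
    refine (MeasureTheory.intervalIntegral_tendsto_integral_Ioi a hint tendsto_id).congr' ?_
    filter_upwards [eventually_ge_atTop a] with R hR
    exact integral_ray_eq_sub hΦ' hhc hR hray
  have hdiff : Tendsto (fun R : ℝ => (Φ (q₁ + R * u₁) - Φ (q₁ + a * u₁)) - (Φ (q₂ + R * u₂) - Φ (q₂ + a * u₂)))
      atTop (𝓝 ((∫ s in Ioi a, h (q₁ + s * u₁) * u₁) - ∫ s in Ioi a, h (q₂ + s * u₂) * u₂)) :=
    (hlim q₁ u₁ hray₁ hint₁).sub (hlim q₂ u₂ hray₂ hint₂)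
  -- the far connector dies
  have hfarlim : Tendsto (fun R : ℝ => Φ (q₂ + R * u₂) - Φ (q₁ + R * u₁)) atTop (𝓝 0) := by
    have hM' : Tendsto (fun R => |M R|) atTop (𝓝 0) := by simpa using hM.abs
    refine squeeze_zero_norm' ?_ hM'
    filter_upwards [hfar, eventually_ge_atTop a] with R ⟨B, hB, hBM⟩ hR
    have hsegR : segment ℝ (q₁ + R * u₁) (q₂ + R * u₂) ⊆ U := hUc.segment_subset (hray₁ R hR) (hray₂ R hR)
    have hmv := Convex.norm_image_sub_le_of_norm_hasDerivWithin_le (f := Φ) (f' := h)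
      (s := segment ℝ (q₁ + R * u₁) (q₂ + R * u₂)) (fun x hx => (hΦ' x (hsegR hx)).hasDerivWithinAt) hB
      (convex_segment _ _) (left_mem_segment ℝ _ _) (right_mem_segment ℝ _ _)
    exact hmv.trans (hBM.trans (le_abs_self _))
  -- assemble: `(Φ₁(R) − Φ p₁) − (Φ₂(R) − Φ p₂) = −(Φ₂(R) − Φ₁(R)) + (Φ p₂ − Φ p₁) → Φ p₂ − Φ p₁`
  have hdiff' : Tendsto (fun R : ℝ => (Φ (q₁ + R * u₁) - Φ (q₁ + a * u₁)) - (Φ (q₂ + R * u₂) - Φ (q₂ + a * u₂)))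
      atTop (𝓝 (-(0 : ℂ) + (Φ p₂ - Φ p₁))) := by
    have h := hfarlim.neg.add (tendsto_const_nhds (x := Φ p₂ - Φ p₁))
    refine h.congr fun R => ?_
    simp only [hp₁, hp₂]; ring
  have huniq := tendsto_nhds_unique hdiff hdiff'
  rw [huniq, hsegval]
  ring

/-- **Horizontal shift of a Laplace-type ray.**  `h` holomorphic on a convex open `U` containing the rays `s ↦ s` and
`s ↦ b + s` (`s ≥ 0`); both ray integrals absolutely convergent; `‖h(R + σb)‖ ≤ C₀·e^{−λR}` for `R ≥ R₁`, `σ ∈ [0,1]` (`λ > 0`) —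
the connector `[R, b + R]` then has `sup‖h‖ × length ≤ C₀‖b‖e^{−λR} → 0`.  Then
`∫_{s>0} h(s) ds − ∫_{s>0} h(b + s) ds = ∫₀¹ h(σb)·b dσ` (`integral_ray_sub_integral_ray_eq_segment` with `u₁ = u₂ = 1`, `a = 0`).
[cite: LodayRichaud2016, Thm 5.3.9 (i)⇒(ii), path γ_b] -/
theorem integral_Ioi_sub_integral_Ioi_shift {U : Set ℂ} (hUo : IsOpen U) (hUc : Convex ℝ U) {h : ℂ → ℂ}
    (hh : DifferentiableOn ℂ h U) {b : ℂ} (hray₁ : ∀ s : ℝ, 0 ≤ s → (s : ℂ) ∈ U)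
    (hray₂ : ∀ s : ℝ, 0 ≤ s → b + (s : ℂ) ∈ U)
    (hint₁ : IntegrableOn (fun s : ℝ => h s) (Ioi 0)) (hint₂ : IntegrableOn (fun s : ℝ => h (b + s)) (Ioi 0))
    {C₀ lam R₁ : ℝ} (hlam : 0 < lam)
    (hdecay : ∀ R : ℝ, R₁ ≤ R → ∀ σ : ℝ, σ ∈ Icc (0 : ℝ) 1 → ‖h ((R : ℂ) + (σ : ℂ) * b)‖ ≤ C₀ * Real.exp (-(lam * R))) :
    (∫ s in Ioi (0 : ℝ), h s) - (∫ s in Ioi (0 : ℝ), h (b + s)) = ∫ σ in (0 : ℝ)..1, h ((σ : ℂ) * b) * b := by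
  have hray₁' : ∀ s : ℝ, (0 : ℝ) ≤ s → (0 : ℂ) + (s : ℂ) * 1 ∈ U := fun s hs => by simpa using hray₁ s hs
  have hray₂' : ∀ s : ℝ, (0 : ℝ) ≤ s → b + (s : ℂ) * 1 ∈ U := fun s hs => by simpa using hray₂ s hs
  have hint₁' : IntegrableOn (fun s : ℝ => h (0 + (s : ℂ) * 1) * 1) (Ioi 0) :=
    hint₁.congr_fun (fun s _ => by simp) measurableSet_Ioi
  have hint₂' : IntegrableOn (fun s : ℝ => h (b + (s : ℂ) * 1) * 1) (Ioi 0) :=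
    hint₂.congr_fun (fun s _ => by simp) measurableSet_Ioi
  have hM : Tendsto (fun R : ℝ => C₀ * Real.exp (-(lam * R)) * ‖b‖) atTop (𝓝 0) := by
    have h1 : Tendsto (fun R : ℝ => Real.exp (-(lam * R))) atTop (𝓝 0) := by
      have := Real.tendsto_exp_neg_atTop_nhds_zero.comp (tendsto_id.const_mul_atTop hlam)
      exact this.congr fun R => by simp [Function.comp]
    simpa using (h1.const_mul C₀).mul_const ‖b‖
  have hfar : ∀ᶠ R : ℝ in atTop, ∃ Bd : ℝ, (∀ w ∈ segment ℝ ((0 : ℂ) + (R : ℂ) * 1) (b + (R : ℂ) * 1), ‖h w‖ ≤ Bd) ∧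
      Bd * ‖(b + (R : ℂ) * 1) - ((0 : ℂ) + (R : ℂ) * 1)‖ ≤ C₀ * Real.exp (-(lam * R)) * ‖b‖ := by
    filter_upwards [eventually_ge_atTop R₁] with R hR
    refine ⟨C₀ * Real.exp (-(lam * R)), fun w hw => ?_, le_of_eq ?_⟩
    · rw [segment_eq_image] at hw
      obtain ⟨σ, hσ, rfl⟩ := hw
      have e : (1 - σ) • ((0 : ℂ) + (R : ℂ) * 1) + σ • (b + (R : ℂ) * 1) = (R : ℂ) + (σ : ℂ) * b := by
        simp only [Complex.real_smul]; push_cast; ring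
      show ‖h ((1 - σ) • ((0 : ℂ) + (R : ℂ) * 1) + σ • (b + (R : ℂ) * 1))‖ ≤ _
      rw [e]; exact hdecay R hR σ hσ
    · congr 1; simp
  have key := integral_ray_sub_integral_ray_eq_segment hUo hUc hh hray₁' hray₂' hint₁' hint₂' hM hfar
  simpa using key

end

end Summit.QuantumFields.BalabanUV.Beta.EriceFlowEnclosureBorelShiftedRays
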